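import Literature.Computability.QuantumComplexity.ConeSimModel
import HarnessLib

/-!
# The cone simulator, II: the gate loop, the acceptance statistic and the exact sign, in `FP`

Topic `Literature/Computability/QuantumComplexity`, continuing `ConeSimStep.lean` (`gateUpdF`: one
gate of the exact state-vector DP of `StateVectorDP.lean` on a coded table, `tableEnc`,
`partialSum`, `clipAt`) and `ConeSimModel.lean` (`tblStep`, `tblRun`: the list-level model of the
table through a gate list; `statU`, `statV`). This file closes the window-agnostic CORE of the
simulator:

* the **gate loop** `gateLoopF` on `W₀ = ⟨⟨ŷ, table₀⟩, codes⟩` (fold of `gateUpdF` over the gate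
  codes, the table clipped at the yardstick after each gate, with the unary count of Hadamard gates
  alongside): value `gateLoopF_genuine` = `⟨tableEnc (tblRun gs l₀), 1^{hCount gs}⟩` under the
  shortness hypotheses `TblShort`/`SumsShort` (clipping never bites);
* the **statistic fold** `statsF` on `⟨ŷ, table⟩`: `⟨dpEnc U, dpEnc V⟩` with
  `U = Σ_{z₀ = 1} zwU a_z`, `V = Σ_{z₀ = 1} zwV a_z` (`statU`, `statV`; value `statsF_genuine`);
* the **verdict** `verdictF` on `⟨⟨U, V⟩, 1^h⟩`: the bit `posSqrtTwoTest (2U − 2^h) (2V)` of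
  `StateVectorDP.lean` (`verdictF_value`), and the assembled `simCoreF` with `simCoreF_mem_FP` and its
  value `simCoreF_genuine`.

All string functions are total and in `FP` unconditionally; the value theorems carry the
shortness side conditions, discharged by the size analysis of the sequel.

## References

* S. Arora, B. Barak, *Computational Complexity: A Modern Approach*, CUP 2009, §1.3.
* M. A. Nielsen, I. L. Chuang, *Quantum Computation and Quantum Information*, CUP 2010, §4.5.5,
  §2.2.5.
* I. L. Markov, Y. Shi, *Simulating quantum computation by contracting tensor networks*, SIAM J.
  Comput. 38 (2008), §1 (deterministic simulation: exact outcome probabilities).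
-/

noncomputable section

namespace Literature.Computability.QuantumComplexity

namespace ConeSim

open _root_.Computability Polynomial Complexity Complexity.Brick Cryptography ZW ZWCode ADH

attribute [-simp] Brick.nthF_zero Brick.sndPow_zero

variable {N : ℕ}

/-! ### The gate loop -/

/-- Yardstick of the gate-loop step argument `⟨⟨⟨ŷ, table₀⟩, codes⟩, ⟨g, ⟨table, hc⟩⟩⟩`. [folklore] -/
def y₀F : List Bool → List Bool := fstF ∘ fstF ∘ fstF
/-- The gate code being processed. [folklore] -/
def gc₀F : List Bool → List Bool := fstF ∘ sndF
/-- The current table. [folklore] -/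
def tb₀F : List Bool → List Bool := fstF ∘ sndF ∘ sndF
/-- The current Hadamard count (unary). [folklore] -/
def hc₀F : List Bool → List Bool := sndF ∘ sndF ∘ sndF

/-- **The new table**: `gateUpdF` on `⟨⟨ŷ, g⟩, table⟩`, clipped at the yardstick. [folklore] -/
def newTblF : List Bool → List Bool := clipAt 1 y₀F (gateUpdF ∘ fanoutFn (fanoutFn y₀F gc₀F) tb₀F)

/-- Is the gate code that of a Hadamard gate (empty operation numeral after the tag bit)?
[cite: AroraBarakCC2009, §6.1 (descriptions of circuits)] -/
def isHT : List Bool → List Bool := isNilFn ∘ fstF ∘ List.tail ∘ gc₀F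

/-- **The new Hadamard count.** [folklore] -/
def newHcF : List Bool → List Bool := iteFn isHT (List.cons true ∘ hc₀F) hc₀F

/-- **The gate-loop step.** [folklore] -/
def step₀ : List Bool → List Bool := fanoutFn newTblF newHcF

/-- The initial accumulator `⟨table₀, ε⟩` from `W₀ = ⟨⟨ŷ, table₀⟩, codes⟩`. [folklore] -/
def ini₀ : List Bool → List Bool := fanoutFn (sndF ∘ fstF) (fun _ => [])

/-- **The gate loop** on `W₀ = ⟨⟨ŷ, table₀⟩, codes⟩`: the final table and the Hadamard count.
[cite: NielsenChuang2010, §4.5.5] -/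
def gateLoopF : List Bool → List Bool := foldFn step₀ ini₀

/-- `y₀F ∈ FP`. [folklore] -/
theorem y₀F_mem_FP : y₀F ∈ FP := comp_mem_FP fstF_mem_FP (comp_mem_FP fstF_mem_FP fstF_mem_FP)
/-- `gc₀F ∈ FP`. [folklore] -/
theorem gc₀F_mem_FP : gc₀F ∈ FP := comp_mem_FP fstF_mem_FP sndF_mem_FP
/-- `tb₀F ∈ FP`. [folklore] -/
theorem tb₀F_mem_FP : tb₀F ∈ FP := comp_mem_FP fstF_mem_FP (comp_mem_FP sndF_mem_FP sndF_mem_FP)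
/-- `hc₀F ∈ FP`. [folklore] -/
theorem hc₀F_mem_FP : hc₀F ∈ FP := comp_mem_FP sndF_mem_FP (comp_mem_FP sndF_mem_FP sndF_mem_FP)
/-- `newTblF ∈ FP`. [folklore] -/
theorem newTblF_mem_FP : newTblF ∈ FP :=
  clipAt_mem_FP 1 y₀F_mem_FP (comp_mem_FP gateUpdF_mem_FP (fanoutFn_mem_FP (fanoutFn_mem_FP y₀F_mem_FP gc₀F_mem_FP) tb₀F_mem_FP))
/-- `isHT ∈ FP`. [folklore] -/
theorem isHT_mem_FP : isHT ∈ FP :=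
  comp_mem_FP isNilFn_mem_FP (comp_mem_FP fstF_mem_FP (comp_mem_FP PRelSigma.tail_mem_FP gc₀F_mem_FP))
/-- `newHcF ∈ FP`. [folklore] -/
theorem newHcF_mem_FP : newHcF ∈ FP := iteFn_mem_FP isHT_mem_FP (comp_mem_FP (cons_mem_FP true) hc₀F_mem_FP) hc₀F_mem_FP
/-- `step₀ ∈ FP`. [folklore] -/
theorem step₀_mem_FP : step₀ ∈ FP := fanoutFn_mem_FP newTblF_mem_FP newHcF_mem_FP
/-- `ini₀ ∈ FP`. [folklore] -/
theorem ini₀_mem_FP : ini₀ ∈ FP := fanoutFn_mem_FP (comp_mem_FP sndF_mem_FP fstF_mem_FP) (const_mem_FP _)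

/-- `isHT` is one-bit. [folklore] -/
theorem oneBit_isHT : OneBit isHT := oneBit_isNilFn.comp _

/-- Value of `newHcF` on every string. [folklore] -/
theorem newHcF_apply (v : List Bool) : newHcF v = if isHT v = [true] then true :: hc₀F v else hc₀F v := by
  rw [newHcF, iteFn_of_oneBit oneBit_isHT]; rfl

/-- **The gate-loop step has total growth `FoldGrowth 5`.** [folklore] -/
theorem foldGrowth_step₀ : FoldGrowth 5 step₀ := fun v => by
  have hy : (y₀F v).length ≤ (fstF v).length := by
    have h1 := length_fstF_sndF_le (fstF v)
    have h2 := length_fstF_sndF_le (fstF (fstF v))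
    simp only [y₀F, Function.comp_apply]
    omega
  have hhc : (hc₀F v).length ≤ (sndF (sndF v)).length := by
    have := length_fstF_sndF_le (sndF (sndF v))
    simp only [hc₀F, Function.comp_apply]
    omega
  have hn := length_clipAt_le 1 y₀F (gateUpdF ∘ fanoutFn (fanoutFn y₀F gc₀F) tb₀F) v
  have hh : (newHcF v).length ≤ (hc₀F v).length + 1 := by
    rw [newHcF_apply]; split_ifs <;> simp
  rw [step₀, length_fanoutFn]
  simp only [newTblF] at hn ⊢
  nlinarith

/-- **`gateLoopF ∈ FP`.** [cite: AroraBarakCC2009, §1.3] -/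
theorem gateLoopF_mem_FP : gateLoopF ∈ FP := foldFn_mem_FP step₀_mem_FP ini₀_mem_FP foldGrowth_step₀

/-! ### Values of the gate loop -/

/-- The tag and operation numeral of the code of an oracle-free gate: the code is
`0 :: ⟨bin op, …⟩` with `op` empty exactly for `H`. [cite: AroraBarakCC2009, §6.1] -/
theorem fstF_tail_encode (g : QGate cliffordT N) (hg : g.IsOracleFree) :
    (fstF (List.tail g.encode) = []) ↔ QGateIsH g = true := by
  cases g with
  | oracle k e => exact absurd hg id
  | gate op e =>
    cases op
    · rw [encode_gateH]; simp [QGateIsH]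
    · rw [encode_gateS]; simp [QGateIsH]
    · rw [encode_gateT]; simp [QGateIsH]
    · rw [encode_gateCNOT]; simp [QGateIsH]

section LoopValues

variable (Y T₀ E : List Bool)

/-- All tables along the run are short. [folklore] -/
def TblShort (Y : List Bool) (gs : List (QGate cliffordT N)) (l₀ : List (QReg N × ZW)) : Prop :=
  ∀ gs₁ gs₂, gs = gs₁ ++ gs₂ → (tableEnc (tblRun gs₁ l₀)).length ≤ Y.length + 1

/-- All partial sums of all targets along the run are short. [folklore] -/
def SumsShort (Y : List Bool) (gs : List (QGate cliffordT N)) (l₀ : List (QReg N × ZW)) : Prop :=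
  ∀ gs₁ g gs₂, gs = gs₁ ++ g :: gs₂ → ∀ z ∈ (tblRun gs₁ l₀).map Prod.fst, ∀ l₁ l₂, tblRun gs₁ l₀ = l₁ ++ l₂ →
    (enc (partialSum g z 0 l₁)).length ≤ Y.length + 1

variable {Y T₀ E}

/-- **Value of the gate-loop step on a genuine argument.** [folklore] -/
theorem step₀_genuine (g : QGate cliffordT N) (hg : g.IsOracleFree) (l : List (QReg N × ZW)) (hc : List Bool)
    (hsums : ∀ z ∈ l.map Prod.fst, ∀ l₁ l₂, l = l₁ ++ l₂ → (enc (partialSum g z 0 l₁)).length ≤ Y.length + 1)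
    (htbl : (tableEnc (tblStep g l)).length ≤ Y.length + 1) :
    step₀ (boolPair (boolPair (boolPair Y T₀) E) (boolPair g.encode (boolPair (tableEnc l) hc))) =
      boolPair (tableEnc (tblStep g l)) (if QGateIsH g then true :: hc else hc) := by
  set v := boolPair (boolPair (boolPair Y T₀) E) (boolPair g.encode (boolPair (tableEnc l) hc)) with hv
  have hy : y₀F v = Y := by simp [hv, y₀F]
  have hgc : gc₀F v = g.encode := by simp [hv, gc₀F]
  have htb : tb₀F v = tableEnc l := by simp [hv, tb₀F]
  have hhc : hc₀F v = hc := by simp [hv, hc₀F]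
  have hupd : (gateUpdF ∘ fanoutFn (fanoutFn y₀F gc₀F) tb₀F) v = tableEnc (tblStep g l) := by
    rw [Function.comp_apply, fanoutFn_apply, fanoutFn_apply, hy, hgc, htb, gateUpdF_tableEnc Y g hg l hsums]
    rfl
  have hnew : newTblF v = tableEnc (tblStep g l) := by
    rw [newTblF, clipAt_eq_self, hupd]
    rw [hupd, hy]; simpa using htbl
  have hH : newHcF v = if QGateIsH g then true :: hc else hc := by
    rw [newHcF_apply, hhc]
    have : isHT v = [decide (fstF (List.tail g.encode) = [])] := by
      simp [isHT, hgc, isNilFn]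
    rw [this]
    by_cases h : QGateIsH g = true
    · rw [if_pos (by simpa using (fstF_tail_encode g hg).2 h), if_pos h]
    · rw [if_neg (by simpa using mt (fstF_tail_encode g hg).1 h), if_neg h]
  rw [step₀, fanoutFn_apply, hnew, hH]

/-- **Value of the gate loop on a genuine argument**: the table of the run and the unary Hadamard
count, under the shortness hypotheses. [cite: NielsenChuang2010, §4.5.5] -/
theorem gateLoopF_genuine (gs : List (QGate cliffordT N)) (hgs : ∀ g ∈ gs, g.IsOracleFree)
    (l₀ : List (QReg N × ZW)) (hT : TblShort Y gs l₀) (hS : SumsShort Y gs l₀) :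
    gateLoopF (boolPair (boolPair Y (tableEnc l₀)) (encList (gs.map QGate.encode))) =
      boolPair (tableEnc (tblRun gs l₀)) (ones (hCount gs)) := by
  rw [gateLoopF, foldFn_boolPair, decNil_encList]
  have hini : ini₀ (boolPair (boolPair Y (tableEnc l₀)) (encList (gs.map QGate.encode))) = boolPair (tableEnc l₀) [] := by
    simp [ini₀]
  rw [hini]
  suffices h : ∀ (gs₂ gs₁ : List (QGate cliffordT N)), gs = gs₁ ++ gs₂ →
      (gs₂.map QGate.encode).foldl
        (fun acc a => step₀ (boolPair (boolPair (boolPair Y (tableEnc l₀)) (encList (gs.map QGate.encode))) (boolPair a acc)))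
        (boolPair (tableEnc (tblRun gs₁ l₀)) (ones (hCount gs₁))) =
      boolPair (tableEnc (tblRun (gs₁ ++ gs₂) l₀)) (ones (hCount (gs₁ ++ gs₂))) by
    simpa [tblRun] using h gs [] (by simp)
  intro gs₂
  induction gs₂ with
  | nil => intro gs₁ _; simp
  | cons g gs₂ ih =>
    intro gs₁ hsplit
    have hg : g.IsOracleFree := hgs g (by rw [hsplit]; simp)
    rw [List.map_cons, List.foldl_cons]
    have hstep := step₀_genuine (Y := Y) (T₀ := tableEnc l₀) (E := encList (gs.map QGate.encode)) g hg (tblRun gs₁ l₀)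
      (ones (hCount gs₁)) (hS gs₁ g gs₂ hsplit) (by
        have := hT (gs₁ ++ [g]) gs₂ (by rw [hsplit]; simp)
        rwa [tblRun_append_singleton] at this)
    rw [hstep]
    have h1 : tblStep g (tblRun gs₁ l₀) = tblRun (gs₁ ++ [g]) l₀ := (tblRun_append_singleton gs₁ g l₀).symm
    have h2 : (if QGateIsH g then true :: ones (hCount gs₁) else ones (hCount gs₁)) = ones (hCount (gs₁ ++ [g])) := by
      rw [hCount_append_singleton]
      split_ifs <;> simp [ones, List.replicate_succ]
    rw [h1, h2, ih (gs₁ ++ [g]) (by rw [hsplit]; simp)]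
    simp
where
  /-- The Hadamard count of `gs ++ [g]`. -/
  hCount_append_singleton : ∀ (gs : List (QGate cliffordT N)) (g : QGate cliffordT N),
      hCount (gs ++ [g]) = hCount gs + (if QGateIsH g then 1 else 0)
    | gs, g => by simp [hCount, List.countP_append]

end LoopValues

/-! ### The acceptance statistic -/

/-- Yardstick of the statistic step argument `⟨⟨ŷ, table⟩, ⟨⟨z, a⟩, ⟨U, V⟩⟩⟩`. [folklore] -/
def y₃F : List Bool → List Bool := fstF ∘ fstF
/-- The label of the item. [folklore] -/
def z₃F : List Bool → List Bool := fstF ∘ fstF ∘ sndF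
/-- The amplitude code of the item. [folklore] -/
def a₃F : List Bool → List Bool := sndF ∘ fstF ∘ sndF
/-- The current `U`. [folklore] -/
def u₃F : List Bool → List Bool := fstF ∘ sndF ∘ sndF
/-- The current `V`. [folklore] -/
def v₃F : List Bool → List Bool := sndF ∘ sndF ∘ sndF

/-- **The statistic step**: add `zwU a`, `zwV a` when wire `0` of the label reads `1`. [folklore] -/
def step₃ : List Bool → List Bool :=
  iteFn (bitT z₃F) (fanoutFn (zaddF ∘ fanoutFn u₃F (zwUF ∘ a₃F)) (zaddF ∘ fanoutFn v₃F (zwVF ∘ a₃F)))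
    (fanoutFn (zcanonF ∘ u₃F) (zcanonF ∘ v₃F))

/-- The statistic step clipped at the yardstick. [folklore] -/
def step₃c : List Bool → List Bool := clipAt 1 y₃F step₃

/-- **The statistic fold** on `⟨ŷ, table⟩`: `⟨dpEnc U, dpEnc V⟩`. [cite: NielsenChuang2010, §2.2.5] -/
def statsF : List Bool → List Bool := foldFn step₃c (fun _ => boolPair (dpEnc 0) (dpEnc 0))

/-- `step₃ ∈ FP`. [folklore] -/
theorem step₃_mem_FP : step₃ ∈ FP := by
  have hz : z₃F ∈ FP := comp_mem_FP fstF_mem_FP (comp_mem_FP fstF_mem_FP sndF_mem_FP)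
  have ha : a₃F ∈ FP := comp_mem_FP sndF_mem_FP (comp_mem_FP fstF_mem_FP sndF_mem_FP)
  have hu : u₃F ∈ FP := comp_mem_FP fstF_mem_FP (comp_mem_FP sndF_mem_FP sndF_mem_FP)
  have hv : v₃F ∈ FP := comp_mem_FP sndF_mem_FP (comp_mem_FP sndF_mem_FP sndF_mem_FP)
  exact iteFn_mem_FP (bitT_mem_FP hz)
    (fanoutFn_mem_FP (comp_mem_FP zaddF_mem_FP (fanoutFn_mem_FP hu (comp_mem_FP zwUF_mem_FP ha)))
      (comp_mem_FP zaddF_mem_FP (fanoutFn_mem_FP hv (comp_mem_FP zwVF_mem_FP ha))))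
    (fanoutFn_mem_FP (comp_mem_FP zcanonF_mem_FP hu) (comp_mem_FP zcanonF_mem_FP hv))

/-- `step₃c` has total growth `FoldGrowth 1`. [folklore] -/
theorem foldGrowth_step₃c : FoldGrowth 1 step₃c := fun v =>
  (length_clipAt_le 1 y₃F step₃ v).trans (by
    have : (y₃F v).length ≤ (fstF v).length := by
      have := length_fstF_sndF_le (fstF v); simp only [y₃F, Function.comp_apply]; omega
    omega)

/-- **`statsF ∈ FP`.** [cite: AroraBarakCC2009, §1.3] -/
theorem statsF_mem_FP : statsF ∈ FP :=
  foldFn_mem_FP (clipAt_mem_FP 1 (comp_mem_FP fstF_mem_FP fstF_mem_FP) step₃_mem_FP) (const_mem_FP _) foldGrowth_step₃c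

/-- Value of the statistic step on every string: both sums canonical, updated iff the label's first
bit is `1`. [folklore] -/
theorem step₃_apply (v : List Bool) :
    step₃ v = boolPair (dpEnc (ival (u₃F v) + if headBit (z₃F v) then zwU (dec (a₃F v)) else 0))
      (dpEnc (ival (v₃F v) + if headBit (z₃F v) then zwV (dec (a₃F v)) else 0)) := by
  rw [step₃, iteFn_apply (bitT_apply z₃F v)]
  cases headBit (z₃F v) <;> simp

/-- All partial statistics are short. [folklore] -/
def StatsShort (Y : List Bool) (l : List (QReg N × ZW)) : Prop :=
  ∀ l₁ l₂, l = l₁ ++ l₂ → (boolPair (dpEnc (statU l₁)) (dpEnc (statV l₁))).length ≤ Y.length + 1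

/-- **Value of the statistic fold on a genuine table.** [cite: NielsenChuang2010, §2.2.5] -/
theorem statsF_genuine (Y : List Bool) (l : List (QReg N × ZW)) (hsh : StatsShort Y l) :
    statsF (boolPair Y (tableEnc l)) = boolPair (dpEnc (statU l)) (dpEnc (statV l)) := by
  rw [statsF, foldFn_boolPair, decNil_tableEnc]
  suffices h : ∀ l₂ l₁ : List (QReg N × ZW), l = l₁ ++ l₂ →
      (l₂.map itemEnc).foldl (fun acc a => step₃c (boolPair (boolPair Y (tableEnc l)) (boolPair a acc)))
        (boolPair (dpEnc (statU l₁)) (dpEnc (statV l₁))) = boolPair (dpEnc (statU (l₁ ++ l₂))) (dpEnc (statV (l₁ ++ l₂))) by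
    simpa [statU, statV] using h l [] (by simp)
  intro l₂
  induction l₂ with
  | nil => intro l₁ _; simp
  | cons p l₂ ih =>
    intro l₁ hl
    rw [List.map_cons, List.foldl_cons]
    have hval : step₃ (boolPair (boolPair Y (tableEnc l)) (boolPair (itemEnc p) (boolPair (dpEnc (statU l₁)) (dpEnc (statV l₁))))) =
        boolPair (dpEnc (statU (l₁ ++ [p]))) (dpEnc (statV (l₁ ++ [p]))) := by
      rw [step₃_apply]
      simp [z₃F, a₃F, u₃F, v₃F, itemEnc, statU, statV]
    have hstep : step₃c (boolPair (boolPair Y (tableEnc l)) (boolPair (itemEnc p) (boolPair (dpEnc (statU l₁)) (dpEnc (statV l₁))))) =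
        boolPair (dpEnc (statU (l₁ ++ [p]))) (dpEnc (statV (l₁ ++ [p]))) := by
      rw [step₃c, clipAt_eq_self, hval]
      rw [hval]
      have hy : y₃F (boolPair (boolPair Y (tableEnc l)) (boolPair (itemEnc p) (boolPair (dpEnc (statU l₁)) (dpEnc (statV l₁))))) = Y := by
        simp [y₃F]
      rw [hy]
      simpa using hsh (l₁ ++ [p]) l₂ (by rw [hl]; simp)
    rw [hstep, ih (l₁ ++ [p]) (by rw [hl]; simp)]
    simp

/-! ### The verdict -/

/-- The numeral of `2^h` from the unary count `1^h`: `0^h 1`. [folklore] -/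
def pow2UF : List Bool → List Bool := OracleCompose.concatFn ∘ fanoutFn Kannan.zerosFn (fun _ => [true])

/-- Value of `pow2UF`: a difference pair of value `2^{|u|}` when read by `ival ⟨·, ε⟩`. [folklore] -/
theorem bitsToNat_pow2F (u : List Bool) : bitsToNat (pow2UF u) = 2 ^ u.length := by
  simp [pow2UF, bitsToNat_append]

/-- `pow2UF ∈ FP`. [folklore] -/
theorem pow2UF_mem_FP : pow2UF ∈ FP :=
  comp_mem_FP OracleCompose.concatFn_mem_FP (fanoutFn_mem_FP Kannan.zerosFn_mem_FP (const_mem_FP _))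

/-- **The verdict** on `⟨⟨U, V⟩, 1^h⟩`: the bit `posSqrtTwoTest (2U − 2^h) (2V)`, i.e.
`[acceptance probability > 1/2]` for the table of the DP (`half_lt_probAcc_iff`).
[cite: MarkovShi2008, §1 (deterministic simulation: the exact probability)] -/
def verdictF : List Bool → List Bool :=
  posTestF ∘ fanoutFn
    (zsubF ∘ fanoutFn (zaddF ∘ fanoutFn (fstF ∘ fstF) (fstF ∘ fstF)) (fanoutFn (pow2UF ∘ sndF) (fun _ => [])))
    (zaddF ∘ fanoutFn (sndF ∘ fstF) (sndF ∘ fstF))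

/-- `verdictF ∈ FP`. [cite: AroraBarakCC2009, §1.3] -/
theorem verdictF_mem_FP : verdictF ∈ FP :=
  comp_mem_FP posTestF_mem_FP (fanoutFn_mem_FP
    (comp_mem_FP zsubF_mem_FP (fanoutFn_mem_FP
      (comp_mem_FP zaddF_mem_FP (fanoutFn_mem_FP (comp_mem_FP fstF_mem_FP fstF_mem_FP) (comp_mem_FP fstF_mem_FP fstF_mem_FP)))
      (fanoutFn_mem_FP (comp_mem_FP pow2UF_mem_FP sndF_mem_FP) (const_mem_FP _))))
    (comp_mem_FP zaddF_mem_FP (fanoutFn_mem_FP (comp_mem_FP sndF_mem_FP fstF_mem_FP) (comp_mem_FP sndF_mem_FP fstF_mem_FP))))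

/-- **Value of the verdict.** [folklore] -/
theorem verdictF_value (U V hc : List Bool) :
    verdictF (boolPair (boolPair U V) hc) = [posSqrtTwoTest (2 * ival U - 2 ^ hc.length) (2 * ival V)] := by
  rw [verdictF, Function.comp_apply, fanoutFn_apply, posTestF_boolPair]
  simp only [Function.comp_apply, fanoutFn_apply, fstF_boolPair, sndF_boolPair, zsubF_boolPair, zaddF_boolPair,
    ival_dpEnc, ival_boolPair, bitsToNat_pow2F, bitsToNat_nil, Nat.cast_zero, sub_zero, Nat.cast_pow, Nat.cast_ofNat]
  congr 2 <;> ring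

/-- The verdict is one-bit. [folklore] -/
theorem oneBit_finalF : OneBit verdictF := oneBit_posTestF.comp _

/-! ### The core -/

/-- **The window-agnostic core of the simulator** on `W₀ = ⟨⟨ŷ, table₀⟩, codes⟩`: gate loop,
statistic, verdict. [cite: MarkovShi2008, §1 (Cor. 1.2: logarithmic treewidth ⟹ polynomial time)] -/
def simCoreF : List Bool → List Bool :=
  verdictF ∘ fanoutFn (statsF ∘ fanoutFn (fstF ∘ fstF) (fstF ∘ gateLoopF)) (sndF ∘ gateLoopF)

/-- **`simCoreF ∈ FP`.** [cite: AroraBarakCC2009, §1.3] -/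
theorem simCoreF_mem_FP : simCoreF ∈ FP :=
  comp_mem_FP verdictF_mem_FP (fanoutFn_mem_FP
    (comp_mem_FP statsF_mem_FP (fanoutFn_mem_FP (comp_mem_FP fstF_mem_FP fstF_mem_FP) (comp_mem_FP fstF_mem_FP gateLoopF_mem_FP)))
    (comp_mem_FP sndF_mem_FP gateLoopF_mem_FP))

/-- The core is one-bit. [folklore] -/
theorem oneBit_coreF : OneBit simCoreF := oneBit_finalF.comp _

/-- **Value of the core on a genuine argument**: the sign bit of the DP table of the run, under the
shortness hypotheses. [cite: MarkovShi2008, §1] -/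
theorem simCoreF_genuine (Y : List Bool) (gs : List (QGate cliffordT N)) (hgs : ∀ g ∈ gs, g.IsOracleFree)
    (l₀ : List (QReg N × ZW)) (hT : TblShort Y gs l₀) (hS : SumsShort Y gs l₀) (hst : StatsShort Y (tblRun gs l₀)) :
    simCoreF (boolPair (boolPair Y (tableEnc l₀)) (encList (gs.map QGate.encode))) =
      [posSqrtTwoTest (2 * statU (tblRun gs l₀) - 2 ^ hCount gs) (2 * statV (tblRun gs l₀))] := by
  have hg := gateLoopF_genuine (Y := Y) gs hgs l₀ hT hS
  simp only [simCoreF, Function.comp_apply, fanoutFn_apply, fstF_boolPair, sndF_boolPair, hg]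
  rw [statsF_genuine Y _ hst, verdictF_value]
  simp [ones]

end ConeSim

end Literature.Computability.QuantumComplexity

end
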